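import Summits.KontsevichZagierPeriods.KontsevichZagierPeriods.Theses.WickWedge

/-!
# `KernelC` (stmt-KontsevichZagierPeriods-10546, route WickWedge, auto-crux rank 9) — birth skeleton

Crux (the complex exponential kernel conjecture for the five moves of `KZexpC`, posed in
KontsevichZagierPeriods2001 §4.3; GPC-strength, motivic shadow FresanJossen2020 Conj. 8.2.6):
`∀ c : KZexpC.FormalRep, KZexpC.eval c = 0 → c ∈ KZexpC.relations`.

Line `birth` = DESCENT ALONG THE TOWER `KZ ⊂ KZexp ⊂ KZexpC` (the route header's own "descend in two
steps" plan, read on the KERNEL instead of on the relations), cut into four named pieces over existing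
declarations only (`Literature.NumberTheory.Transcendental.{KZ,KZexp,KZexpC}.*`, Mathlib):

* `stub_saturated` (structure of the move group, PROVABLE NOW, size M/L): `KZexpC.relations` is a
  saturated subgroup — `0 < k → k • c ∈ relations → c ∈ relations` ("no division by integers is a
  rule", Statement docstring; every averaging step `c + conj c`, every symmetrisation produces integer
  multiples). Plan: the division endomorphism `D_k [σ, f, g, θ] = [σ, f/k, g, θ]` preserves each of the
  five move families (they are linear in the integrand / the primitive coefficients `hᵢ`, exactly as in
  `KZexpC.conjMap_image_…_subset`), and `k • [σ, f/k, g, θ] ≡ [σ, f, g, θ]` by `k − 1` integrand-additivity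
  moves; then `k • c ∈ relations ⇒ k • D_k c ∈ relations ⇒ c ∈ relations`.
* `stub_classicalKernel` (the WICK-WEDGE ENGINE IN UNIVERSAL FORM; open, transcendence-free): every null
  `ℤ`-combination of CLASSICAL representations is a relation of the COMPLEX-phase calculus,
  `KZ.eval c = 0 → inclC (incl c) ∈ KZexpC.relations`. This is exactly the instance of `KernelC` that the
  route's deciding theorem `closes` consumes (it applies `KernelC` to `inclC (incl ([r] − [r']))`), it is
  IMPLIED by the summit (kernel form `KZKernelConjecture` + `KZexpC.le_comap_inclC_incl`), and its typed
  instances are the route's corpus (SumRuleSix ⇐ TInsertion + SumRuleSixC: Bessel-moment relations become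
  finite KZexpC chains through Wick rotations). Why it might fail: an additive invariant of the five complex
  moves finer than `eval` on classical combinations (none known: refuter notes g44-4 / g45-23 on the item).
* `stub_phaseElimination` (open; the genuinely EXPONENTIAL-vs-oscillatory content, first layer of the
  tower): modulo complex moves and up to a positive integer multiple, a null combination of complex-PHASE
  representations is a null combination of REAL-weight ones: `eval c = 0 → ∃ k > 0, ∃ c₁, KZexp.eval c₁ = 0 ∧
  k • c − inclC c₁ ∈ relations`. The phases of the route's chains are born from Newton–Leibniz moves in a
  direction where `θ` varies (`∂_t (h e^{-g-iθ}) = (∂_t h − h ∂_t g − i h ∂_t θ) e^{-g-iθ}`) and die the same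
  way (improper move (3b) with a one-term boundary); the multiple `k` absorbs `c + conjMap c = 2 Re`
  (`KZexpC.eval_conjMap`, `conjMap_mem_relations_iff`). Why it might fail: the one-representation boundary
  terms of (3a)/(3b) (the crux's own calculus-size risk: `F(x,b) − F(x,a)` must be ONE weighted integrand).
* `stub_weightElimination` (open; second layer, the LAPLACE-LAYER RETRACTION of the route header, but with
  complex detours allowed): modulo COMPLEX moves and up to a multiple, a null combination of real-weight
  representations is a null combination of classical ones: `KZexp.eval c₁ = 0 → ∃ k > 0, ∃ c₀, KZ.eval c₀ = 0 ∧
  k • inclC c₁ − inclC (incl c₀) ∈ relations`. Implied by ExpConservative's 0531 (`KZexp.KernelConjecture`,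
  `k = 1`, `c₀ = 0`, `KZexpC.inclC_mem_relations`) but strictly weaker where this route expects 0531 to fail
  (SumRuleSixExp): the chain may rotate contours. Instances: `TInsertion` (Schwinger `t`-insertion is one
  improper move), the Gaussian `[ℝ², 1, x²+y², 0] ≡ 2·[ℝ, 1/(2(1+v²)), 0, 0]` (rule 2 + one improper move).
  Why it might fail: a null real-exponential combination whose only reductions to classical data need a
  product/Fubini move the calculus lacks.

Composition (sorry-free): `kernelC_of_stubs : stub₁-sig → stub₂-sig → stub₃-sig → stub₄-sig → (∀ c, eval c = 0 →
c ∈ relations)` — given `eval c = 0`: phase elimination gives `k₁ • c ≡ inclC c₁` with `c₁` null, weight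
elimination gives `k₂ • inclC c₁ ≡ inclC (incl c₀)` with `c₀` null, the classical kernel makes
`inclC (incl c₀)` a relation, hence `k₂ • k₁ • c ∈ relations`, and saturation (twice) gives `c ∈ relations`.
`KernelC_of : KernelC` feeds the four stubs in BY NAME (the theorem `#h21_check_skeleton` keys on; the arrow
form concludes the unfolded statement so that exactly one theorem of this file concludes the crux by name).
Soundness of the complex moves (`relations ≤ eval.ker`, not in the tree) is NOT used.

Disproof used: none on file (no `Cruxes/KernelC/Disproof.lean`, no dead lines; `ledger negatives
--problem KontsevichZagierPeriods` lists one unrelated statement, KinematicFormulas 5394). Remark for the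
tenure planner (not acted on here): `closes` factors through `stub_classicalKernel`, which is implied by the
summit — replacing `KernelC` by it in `closes` would make the route's X = ComplexDescent ∧ ClassicalKernelC
EQUIVALENT to the summit (granted soundness) instead of GPC-stronger.
-/

noncomputable section

namespace Summit.KontsevichZagierPeriods.WickWedge.KernelCBirth

open Summit.KontsevichZagierPeriods.KontsevichZagierPeriods.Theses.WickWedge (KernelC)

/-! ## The four stubs -/

/-- Stub 1 — SATURATION of the complex move group (provable now, size M/L): if a positive integer
multiple of a formal combination is a `KZexpC` relation, so is the combination ("no division by
integers is a rule" — it has to be a theorem). Plan: the division endomorphism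
`D_k [σ, f, g, θ] = [σ, f/k, g, θ]` maps each of the five move sets into itself (linearity in `f` and in
the primitive coefficients `hᵢ`; template `KZexpC.conjMap_image_…_subset` / `map_relations_conjMap_le`),
and `k • [σ, f/k, g, θ] − [σ, f, g, θ] ∈ relations` by `k − 1` moves (1b); so
`k • c ∈ relations ⇒ D_k (k • c) = k • D_k c ∈ relations ⇒ c = k • D_k c − (k • D_k c − c) ∈ relations`.
Sources: KontsevichZagierPeriods2001 §1.2 (rules (1)–(3); this tree's reading "ℤ-span, no division"),
`Literature.NumberTheory.Transcendental.KZexpC.integrandAddRel`. -/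
theorem stub_saturated : ∀ (k : ℕ) (c : Literature.NumberTheory.Transcendental.KZexpC.FormalRep), 0 < k → k • c ∈ Literature.NumberTheory.Transcendental.KZexpC.relations → c ∈ Literature.NumberTheory.Transcendental.KZexpC.relations := by
  sorry

/-- Stub 2 — THE CLASSICAL KERNEL IS COMPLEX-EXPONENTIALLY GENERATED (the Wick-wedge engine in
universal form; open, transcendence-free): every `ℤ`-combination of classical representations with
value `0` is a relation of the complex-phase calculus. Exactly the instance of `KernelC` used by the
route's `closes`; implied by the summit (`kzKernelConjecture_iff_isRational` + `KZexpC.le_comap_inclC_incl`);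
typed instances = the route corpus (SumRuleSix via TInsertion + SumRuleSixC, QuinticOrthogonality).
Why it might fail: an additive invariant of the five complex moves, finer than `eval`, separating two
classical representations of one period (e.g. `[R(3,3;1)]` from `3·[R(1,5;1)]`). Sources:
FresanSabbahYu2023 Cor. 7 / Rem. 8, Zhou2017, KontsevichZagierPeriods2001 §1.2 and §4.3,
`Literature.NumberTheory.Transcendental.KZexpC.map_relations_incl_le`. Size: open-problem. -/
theorem stub_classicalKernel : ∀ c : Literature.NumberTheory.Transcendental.KZ.FormalRep, Literature.NumberTheory.Transcendental.KZ.eval c = 0 → Literature.NumberTheory.Transcendental.KZexpC.inclC (Literature.NumberTheory.Transcendental.KZexp.incl c) ∈ Literature.NumberTheory.Transcendental.KZexpC.relations := by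
  sorry

/-- Stub 3 — PHASE ELIMINATION (open; first layer of the tower `KZ ⊂ KZexp ⊂ KZexpC`): modulo the
five complex moves and up to a positive integer multiple, every null combination of complex-phase
representations is a null combination of REAL-weight (phase-`0`) representations. The multiple absorbs
symmetrisations `c + conjMap c` (`KZexpC.eval_conjMap`: value `2 Re`); phases die by improper moves
(3b) with one-term boundaries, the way the route's Wick rotations create them. Why it might fail:
one-representation boundary terms — `F(x, b x) − F(x, a x)` of move (3a) must be a single weighted
integrand `e^{-g'-iθ'} f'` (the crux's own calculus-size risk). Sources: KontsevichZagierPeriods2001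
§4.3, CommelinHabeggerHuber2020 Thm. 3 (real and imaginary parts of exponential periods) and §5.4,
`Literature.NumberTheory.Transcendental.KZexpC.improperNewtonLeibnizRel`. Size: open-problem. -/
theorem stub_phaseElimination : ∀ c : Literature.NumberTheory.Transcendental.KZexpC.FormalRep, Literature.NumberTheory.Transcendental.KZexpC.eval c = 0 → ∃ (k : ℕ) (c₁ : Literature.NumberTheory.Transcendental.KZexp.FormalRep), 0 < k ∧ Literature.NumberTheory.Transcendental.KZexp.eval c₁ = 0 ∧ k • c - Literature.NumberTheory.Transcendental.KZexpC.inclC c₁ ∈ Literature.NumberTheory.Transcendental.KZexpC.relations := by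
  sorry

/-- Stub 4 — WEIGHT ELIMINATION / LAPLACE-LAYER RETRACTION WITH COMPLEX DETOURS (open; second
layer): modulo the five COMPLEX moves and up to a positive integer multiple, every null combination of
real-weight exponential representations is a null combination of CLASSICAL representations. Implied by
ExpConservative's real kernel conjecture 0531 (`KZexp.KernelConjecture`: `k = 1`, `c₀ = 0`,
`KZexpC.inclC_mem_relations`) and strictly weaker exactly where this route expects 0531 to fail (contour
rotation allowed). Instances: route support `TInsertion` (Schwinger `t`-insertion = one improper move),
the Gaussian `[ℝ², 1, x²+y², 0]` (rule 2 `(x,y) ↦ (x²+y², y/x)` on half-planes + one improper move ↦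
`[ℝ, 1/(2(1+v²))]`). Why it might fail: a null real-exponential combination whose reductions to
classical data all need a product/Fubini move the calculus lacks. Sources: KontsevichZagierPeriods2001
§4.3, FresanJossen2020 (Thm. 5.1.1, Conj. 8.2.6), `Literature.NumberTheory.Transcendental.KZexp.improperNewtonLeibnizRel`,
`Literature.NumberTheory.Transcendental.KZexpC.inclC_mem_relations`. Size: open-problem. -/
theorem stub_weightElimination : ∀ c₁ : Literature.NumberTheory.Transcendental.KZexp.FormalRep, Literature.NumberTheory.Transcendental.KZexp.eval c₁ = 0 → ∃ (k : ℕ) (c₀ : Literature.NumberTheory.Transcendental.KZ.FormalRep), 0 < k ∧ Literature.NumberTheory.Transcendental.KZ.eval c₀ = 0 ∧ k • Literature.NumberTheory.Transcendental.KZexpC.inclC c₁ - Literature.NumberTheory.Transcendental.KZexpC.inclC (Literature.NumberTheory.Transcendental.KZexp.incl c₀) ∈ Literature.NumberTheory.Transcendental.KZexpC.relations := by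
  sorry

/-! ## The composition (sorry-free) -/

open Literature.NumberTheory.Transcendental

/-- The composition, arrow form: SATURATION → CLASSICAL KERNEL → PHASE ELIMINATION → WEIGHT
ELIMINATION → the crux (UNFOLDED verbatim, so that exactly one theorem of this file, `KernelC_of`,
concludes the crux by name). Given `eval c = 0`: `k₁ • c ≡ inclC c₁` (`c₁` null, stub 3),
`k₂ • inclC c₁ ≡ inclC (incl c₀)` (`c₀` null, stub 4), `inclC (incl c₀) ∈ relations` (stub 2), hence
`k₂ • k₁ • c ∈ relations`, and stub 1 twice. Soundness of the moves is not used.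
[cite: KontsevichZagierPeriods2001, §4.3] -/
theorem kernelC_of_stubs
    (hsat : ∀ (k : ℕ) (c : KZexpC.FormalRep), 0 < k → k • c ∈ KZexpC.relations → c ∈ KZexpC.relations)
    (hcl : ∀ c : KZ.FormalRep, KZ.eval c = 0 → KZexpC.inclC (KZexp.incl c) ∈ KZexpC.relations)
    (hph : ∀ c : KZexpC.FormalRep, KZexpC.eval c = 0 → ∃ (k : ℕ) (c₁ : KZexp.FormalRep), 0 < k ∧
      KZexp.eval c₁ = 0 ∧ k • c - KZexpC.inclC c₁ ∈ KZexpC.relations)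
    (hwt : ∀ c₁ : KZexp.FormalRep, KZexp.eval c₁ = 0 → ∃ (k : ℕ) (c₀ : KZ.FormalRep), 0 < k ∧
      KZ.eval c₀ = 0 ∧ k • KZexpC.inclC c₁ - KZexpC.inclC (KZexp.incl c₀) ∈ KZexpC.relations) :
    ∀ c : KZexpC.FormalRep, KZexpC.eval c = 0 → c ∈ KZexpC.relations := by
  intro c hc
  obtain ⟨k₁, c₁, hk₁, hc₁, h₁⟩ := hph c hc
  obtain ⟨k₂, c₀, hk₂, hc₀, h₂⟩ := hwt c₁ hc₁
  have h₀ : KZexpC.inclC (KZexp.incl c₀) ∈ KZexpC.relations := hcl c₀ hc₀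
  have h₃ : k₂ • KZexpC.inclC c₁ ∈ KZexpC.relations := by
    have h := KZexpC.relations.add_mem h₂ h₀
    rwa [sub_add_cancel] at h
  have h₄ : k₂ • (k₁ • c) ∈ KZexpC.relations := by
    have h₅ : k₂ • (k₁ • c - KZexpC.inclC c₁) ∈ KZexpC.relations := KZexpC.relations.nsmul_mem h₁ k₂
    rw [nsmul_sub] at h₅
    have h := KZexpC.relations.add_mem h₅ h₃
    rwa [sub_add_cancel] at h
  exact hsat k₁ c hk₁ (hsat k₂ (k₁ • c) hk₂ h₄)

/-- **The skeleton theorem** (concludes the crux BY NAME; sorries enter only through the four named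
stubs): `KernelC` from SATURATION, the CLASSICAL KERNEL, PHASE ELIMINATION and WEIGHT ELIMINATION.
[cite: KontsevichZagierPeriods2001, §4.3] -/
theorem KernelC_of : KernelC :=
  kernelC_of_stubs stub_saturated stub_classicalKernel stub_phaseElimination stub_weightElimination

end Summit.KontsevichZagierPeriods.WickWedge.KernelCBirth

end
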